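import Summits.AtomisticToContinuum.FouriersLaw.Theorems.BondHeatUncertaintyExtensiveSnapshotIrreversibilityEnergyWindowFlowJacobianPathwise
import Literature.MathematicalPhysics.KineticTheory.LangevinChainTheorem51

/-!
# Energy window, part S′b — moments of the momentum-direction Jacobian: (JM) PROVED

Lineage `stmt-AtomisticToContinuum-9121` (`ExtensiveSnapshotIrreversibility`), K_fix half, leaf S3
`KernelTemperatureLipschitz`; this file closes the support leaf **(JM) `FlowJacobianMoment`** of
part R (`…EnergyWindowSkeletonWeights`): `theorem flowJacobianMoment : FlowJacobianMoment`.

Imports: S′p (the pathwise bound; S′p imports S′a and part R, which states (JM)) and the tree's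
CEHR exponential moments `LangevinChainTheorem51`.

Proof.  Part S′p gives, for every path, `‖∂_z Φ_s(z)[(0, e_b)]‖ ≤ exp(∫₀ˢ (A₀ + A₁ √H(Φ_u(z))) du)`.
Raise to the power `q ≥ 1`, use Young `q A₁ √H ≤ θ H + q² A₁² / (4θ)` and `s ≤ 1`:
`‖J‖^q ≤ e^{K₁} exp(θ ∫₀ˢ H(Φ_u) du)`, `K₁ = q A₀ + q² A₁² / (4θ)`.  Jensen in time
(`mul_exp_div_le_integral_exp`, proved from `1 + x ≤ eˣ`, no measure-theoretic averages) gives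
`exp(θ ∫₀ˢ H) ≤ s⁻¹ ∫₀ˢ exp(θ H(Φ_u)) du` for `0 < s ≤ 1`, and Tonelli plus the tree's CEHR
exponential moment ALONG THE FLOW at a fixed time
(`pinnedChain_lintegral_exp_hamiltonian_solMap_le`:
`E exp(θ H(Φ_u(z))) ≤ e^{θγ(T_L+T_R)u} e^{θH(z)}`
for `0 < θ < 1 / max(T_L, T_R)`) bound the expectation by `e^{K₁ + θγ(T_L+T_R)} e^{θ H(z)}`
(`lintegral_rpow_norm_fderiv_solMap_le`, any temperatures).  For (JM) take `T_L = T_R = T`,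
`θ = min ε (1/(2T))` and `C = exp(A₀ + q A₁²/(4θ) + 2θγT)`.  No maximal inequality and no moments
of `sup_t H(X_t)` are needed — only fixed-time exponential moments, which the tree has.

[cite: CuneoEckmannHairerReyBellet2018, §3 eq. (3.4)]
-/

noncomputable section

namespace Summit.AtomisticToContinuum.FouriersLaw.Theorems.ExtensiveSnapshotIrreversibility.EnergyWindow

open MeasureTheory Filter Topology Real unitInterval Set
open scoped ENNReal NNReal ContDiff
open Literature.MathematicalPhysics.KineticTheory.HeatConduction
open Literature.Probability.Process Literature.Analysis.ODE

/-! ## 1. Two elementary inequalities -/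

/-- Young: `c √h ≤ θ h + c² / (4θ)` for `h ≥ 0`, `θ > 0`. [folklore] -/
theorem mul_sqrt_le_young {c h θ : ℝ} (hh : 0 ≤ h) (hθ : 0 < θ) :
    c * √h ≤ θ * h + c ^ 2 / (4 * θ) := by
  have hu : √h ^ 2 = h := Real.sq_sqrt hh
  have key : 0 ≤ θ * (√h - c / (2 * θ)) ^ 2 := by positivity
  have hθ0 : θ ≠ 0 := hθ.ne'
  have hexp : θ * (√h - c / (2 * θ)) ^ 2 = θ * √h ^ 2 - c * √h + c ^ 2 / (4 * θ) := by
    field_simp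
    ring
  rw [hexp, hu] at key
  linarith

/-- **Jensen in time for `exp`, from `1 + x ≤ eˣ`**: for continuous `f` and `s > 0`,
`s · exp((∫₀ˢ f)/s) ≤ ∫₀ˢ exp(f u) du`. [folklore] -/
theorem mul_exp_div_le_integral_exp {f : ℝ → ℝ} (hf : Continuous f) {s : ℝ} (hs : 0 < s) :
    s * Real.exp ((∫ u in (0 : ℝ)..s, f u) / s) ≤ ∫ u in (0 : ℝ)..s, Real.exp (f u) := by
  have hs' : s ≠ 0 := hs.ne'
  set m := (∫ u in (0 : ℝ)..s, f u) / s with hm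
  have hpt : ∀ u, Real.exp m * (1 + (f u - m)) ≤ Real.exp (f u) := fun u => by
    calc Real.exp m * (1 + (f u - m)) ≤ Real.exp m * Real.exp (f u - m) :=
          mul_le_mul_of_nonneg_left (by linarith [Real.add_one_le_exp (f u - m)])
            (Real.exp_pos m).le
      _ = Real.exp (f u) := by rw [← Real.exp_add]; congr 1; ring
  have i1 : IntervalIntegrable (fun _ : ℝ => (1 : ℝ)) volume 0 s := intervalIntegrable_const
  have i2 : IntervalIntegrable (fun u => f u - m) volume 0 s :=
    (hf.sub continuous_const).intervalIntegrable 0 s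
  have hsm : s * m = ∫ u in (0 : ℝ)..s, f u := by
    rw [hm]; field_simp
  have hint : ∫ u in (0 : ℝ)..s, Real.exp m * (1 + (f u - m)) = s * Real.exp m := by
    rw [intervalIntegral.integral_const_mul, intervalIntegral.integral_add i1 i2,
      intervalIntegral.integral_sub (hf.intervalIntegrable 0 s) intervalIntegrable_const,
      intervalIntegral.integral_const, intervalIntegral.integral_const]
    simp only [sub_zero, smul_eq_mul, mul_one]
    rw [← hsm]; ring
  calc s * Real.exp m = ∫ u in (0 : ℝ)..s, Real.exp m * (1 + (f u - m)) := by rw [hint]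
    _ ≤ ∫ u in (0 : ℝ)..s, Real.exp (f u) :=
        intervalIntegral.integral_mono_on hs.le
          ((continuous_const.mul
            (continuous_const.add (hf.sub continuous_const))).intervalIntegrable 0 s)
          (hf.rexp.intervalIntegrable 0 s) fun u _ => hpt u

/-! ## 2. The moment bound at fixed exponential-moment parameter `θ` (any temperatures) -/

section Moment

variable {ω₂ lam β γ : ℝ} (hω : 0 < ω₂) (hl : 0 ≤ lam) (hβ : 0 ≤ β) (hγ : 0 ≤ γ) {N : ℕ}
  (hN : 0 < N) {T_L T_R : ℝ} (hTL : 0 < T_L) (hTR : 0 < T_R)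

include hω hl hβ hγ hN hTL hTR in
/-- **`q`-th moment of the momentum-direction Jacobian, controlled by `e^{θ H(z)}`**: for
`q ≥ 1`, `0 < θ < 1 / max(T_L, T_R)`, `s ∈ [0, 1]`, every site `b` and starting point `z`,
`E (‖∂_z Φ_s(z, B)[(0, e_b)]‖)^q ≤ exp(q A₀ + q² A₁²/(4θ) + θγ(T_L+T_R)) · exp(θ H(z))`.
[cite: CuneoEckmannHairerReyBellet2018, §3 eq. (3.4)] -/
theorem lintegral_rpow_norm_fderiv_solMap_le {q : ℝ} (hq : 1 ≤ q) {θ : ℝ} (hθ : 0 < θ)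
    (hθ' : θ < 1 / max T_L T_R) {s : ℝ} (hs : s ∈ Icc (0 : ℝ) 1) (b : Fin N) (z : PhaseSpace N) :
    ∫⁻ wp, ENNReal.ofReal ‖fderiv ℝ
        (fun z' => (pinnedChain ω₂ lam β γ).solMap N T_L T_R s z' (pairPath wp)) z
        ((0 : Fin N → ℝ), Pi.single b 1)‖ ^ q ∂wienerPair ≤
      ENNReal.ofReal (Real.exp (q * driftA₀ ω₂ γ N + q ^ 2 * driftA₁ lam β N ^ 2 / (4 * θ) +
          θ * γ * (T_L + T_R)) * Real.exp (θ * (pinnedChain ω₂ lam β γ).hamiltonian N z)) := by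
  have hq0 : 0 ≤ q := zero_le_one.trans hq
  have hA₀ : 0 ≤ driftA₀ ω₂ γ N := driftA₀_nonneg hω.le hγ N
  have hA₁ : 0 ≤ driftA₁ lam β N := driftA₁_nonneg lam β N
  have hHz : 0 ≤ (pinnedChain ω₂ lam β γ).hamiltonian N z :=
    pinnedChain_hamiltonian_nonneg hω.le hl hβ γ N z
  set K₁ := q * driftA₀ ω₂ γ N + q ^ 2 * driftA₁ lam β N ^ 2 / (4 * θ) with hK₁
  have hK₁0 : 0 ≤ K₁ := by rw [hK₁]; positivity
  clear_value K₁
  have hγT : 0 ≤ θ * γ * (T_L + T_R) := by positivity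
  -- the energy along the path and the Jacobian norm
  set h : WienerPair → ℝ → ℝ := fun wp u =>
    (pinnedChain ω₂ lam β γ).hamiltonian N
      ((pinnedChain ω₂ lam β γ).solMap N T_L T_R u z (pairPath wp)) with hh_def
  have hh0 : ∀ wp u, 0 ≤ h wp u := fun wp u => pinnedChain_hamiltonian_nonneg hω.le hl hβ γ N _
  have hhc : ∀ wp, Continuous (h wp) := fun wp =>
    (pinnedChain_continuous_hamiltonian ω₂ lam β γ N).comp
      (pinnedChain_continuous_solMap hω hl hβ hγ N T_L T_R z (pairPath wp))
  have hhm : ∀ u, Measurable fun wp => h wp u := fun u =>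
    (pinnedChain_continuous_hamiltonian ω₂ lam β γ N).measurable.comp
      (pinnedChain_measurable_solMap_pairPath_right hω hl hβ hγ N T_L T_R u z)
  set J : WienerPair → ℝ := fun wp => ‖fderiv ℝ
      (fun z' => (pinnedChain ω₂ lam β γ).solMap N T_L T_R s z' (pairPath wp)) z
      ((0 : Fin N → ℝ), Pi.single b 1)‖ with hJ_def
  -- Step 1 (pathwise): `J^q ≤ e^{K₁} exp(θ ∫₀ˢ h)`
  have step1 : ∀ wp, J wp ^ q ≤ Real.exp K₁ * Real.exp (θ * ∫ u in (0 : ℝ)..s, h wp u) := by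
    intro wp
    have hJ := norm_fderiv_solMap_momentum_le hω hl hβ hγ N T_L T_R hs b z wp
    set I₁ := ∫ u in (0 : ℝ)..s, (driftA₀ ω₂ γ N + driftA₁ lam β N * √(h wp u)) with hI
    have h1 : J wp ^ q ≤ Real.exp (q * I₁) := by
      rw [mul_comm q I₁, Real.exp_mul]
      exact Real.rpow_le_rpow (norm_nonneg _) hJ hq0
    have hI' : q * I₁ =
        ∫ u in (0 : ℝ)..s, (q * driftA₀ ω₂ γ N + q * driftA₁ lam β N * √(h wp u)) := by
      rw [hI, ← intervalIntegral.integral_const_mul]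
      refine intervalIntegral.integral_congr fun u _ => ?_
      ring
    have hmono : ∫ u in (0 : ℝ)..s, (q * driftA₀ ω₂ γ N + q * driftA₁ lam β N * √(h wp u)) ≤
        ∫ u in (0 : ℝ)..s, (K₁ + θ * h wp u) := by
      refine intervalIntegral.integral_mono_on hs.1 ?_ ?_ fun u _ => ?_
      · exact (continuous_const.add (continuous_const.mul (hhc wp).sqrt)).intervalIntegrable _ _
      · exact (continuous_const.add (continuous_const.mul (hhc wp))).intervalIntegrable _ _
      · have hy := mul_sqrt_le_young (c := q * driftA₁ lam β N) (hh0 wp u) hθ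
        have he : (q * driftA₁ lam β N) ^ 2 / (4 * θ) = q ^ 2 * driftA₁ lam β N ^ 2 / (4 * θ) := by
          ring
        rw [hK₁]; linarith
    have i3 : IntervalIntegrable (fun u => θ * h wp u) volume 0 s :=
      (continuous_const.mul (hhc wp)).intervalIntegrable _ _
    have hconst : ∫ u in (0 : ℝ)..s, (K₁ + θ * h wp u) =
        s * K₁ + θ * ∫ u in (0 : ℝ)..s, h wp u := by
      rw [intervalIntegral.integral_add intervalIntegrable_const i3,
        intervalIntegral.integral_const, intervalIntegral.integral_const_mul, sub_zero, smul_eq_mul]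
    have hsK : s * K₁ ≤ K₁ := mul_le_of_le_one_left hK₁0 hs.2
    have h2 : q * I₁ ≤ K₁ + θ * ∫ u in (0 : ℝ)..s, h wp u := by linarith
    calc J wp ^ q ≤ Real.exp (q * I₁) := h1
      _ ≤ Real.exp (K₁ + θ * ∫ u in (0 : ℝ)..s, h wp u) := Real.exp_le_exp.2 h2
      _ = Real.exp K₁ * Real.exp (θ * ∫ u in (0 : ℝ)..s, h wp u) := Real.exp_add _ _
  -- the right-hand side dominates `e^{K₁}`
  have hRHS : Real.exp K₁ ≤ Real.exp (K₁ + θ * γ * (T_L + T_R)) *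
      Real.exp (θ * (pinnedChain ω₂ lam β γ).hamiltonian N z) := by
    calc Real.exp K₁ = Real.exp K₁ * 1 := (mul_one _).symm
      _ ≤ Real.exp (K₁ + θ * γ * (T_L + T_R)) *
          Real.exp (θ * (pinnedChain ω₂ lam β γ).hamiltonian N z) :=
        mul_le_mul (Real.exp_le_exp.2 (by linarith)) (Real.one_le_exp (by positivity))
          zero_le_one (Real.exp_pos _).le
  rcases hs.1.eq_or_lt with hs0 | hs0
  · -- `s = 0`: `J ≤ 1`, so `J^q ≤ 1 ≤ e^{K₁}`
    have hb : ∀ wp, J wp ^ q ≤ Real.exp K₁ := fun wp => by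
      have h1 := step1 wp
      rw [← hs0, intervalIntegral.integral_same, mul_zero, Real.exp_zero, mul_one] at h1
      exact h1
    calc ∫⁻ wp, ENNReal.ofReal (J wp) ^ q ∂wienerPair
        ≤ ∫⁻ _wp, ENNReal.ofReal (Real.exp K₁) ∂wienerPair :=
          lintegral_mono fun wp => by
            rw [ENNReal.ofReal_rpow_of_nonneg (norm_nonneg _) hq0]
            exact ENNReal.ofReal_le_ofReal (hb wp)
      _ = ENNReal.ofReal (Real.exp K₁) := by rw [lintegral_const, measure_univ, mul_one]
      _ ≤ _ := ENNReal.ofReal_le_ofReal hRHS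
  · -- `0 < s ≤ 1`
    -- Step 2 (pathwise Jensen): `J^q ≤ e^{K₁} s⁻¹ ∫₀ˢ exp(θ h)`
    have bound : ∀ wp, J wp ^ q ≤
        Real.exp K₁ * s⁻¹ * ∫ u in (0 : ℝ)..s, Real.exp (θ * h wp u) := by
      intro wp
      have hI0 : 0 ≤ ∫ u in (0 : ℝ)..s, h wp u :=
        intervalIntegral.integral_nonneg hs.1 fun u _ => hh0 wp u
      have hθI : 0 ≤ θ * ∫ u in (0 : ℝ)..s, h wp u := mul_nonneg hθ.le hI0
      have hcf : Continuous fun u => θ * h wp u := continuous_const.mul (hhc wp)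
      have hjen := mul_exp_div_le_integral_exp hcf hs0
      rw [intervalIntegral.integral_const_mul] at hjen
      have hm : θ * ∫ u in (0 : ℝ)..s, h wp u ≤ (θ * ∫ u in (0 : ℝ)..s, h wp u) / s := by
        rw [le_div_iff₀ hs0]; exact mul_le_of_le_one_right hθI hs.2
      have hexp : Real.exp (θ * ∫ u in (0 : ℝ)..s, h wp u) ≤
          s⁻¹ * ∫ u in (0 : ℝ)..s, Real.exp (θ * h wp u) := by
        rw [le_inv_mul_iff₀ hs0]
        calc s * Real.exp (θ * ∫ u in (0 : ℝ)..s, h wp u)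
            ≤ s * Real.exp ((θ * ∫ u in (0 : ℝ)..s, h wp u) / s) :=
              mul_le_mul_of_nonneg_left (Real.exp_le_exp.2 hm) hs0.le
          _ ≤ ∫ u in (0 : ℝ)..s, Real.exp (θ * h wp u) := hjen
      calc J wp ^ q ≤ Real.exp K₁ * Real.exp (θ * ∫ u in (0 : ℝ)..s, h wp u) := step1 wp
        _ ≤ Real.exp K₁ * (s⁻¹ * ∫ u in (0 : ℝ)..s, Real.exp (θ * h wp u)) :=
            mul_le_mul_of_nonneg_left hexp (Real.exp_pos _).le
        _ = Real.exp K₁ * s⁻¹ * ∫ u in (0 : ℝ)..s, Real.exp (θ * h wp u) := (mul_assoc _ _ _).symm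
    -- Step 3: joint measurability of `(wp, u) ↦ exp(θ h)` (continuous in `u`, measurable in `wp`)
    have hG_meas : Measurable (Function.uncurry fun (u : ℝ) (wp : WienerPair) =>
        ENNReal.ofReal (Real.exp (θ * h wp u))) := by
      have hc : ∀ wp : WienerPair, Continuous fun u : ℝ => ENNReal.ofReal (Real.exp (θ * h wp u)) :=
        fun wp => by
          have h1 : Continuous fun u : ℝ => θ * h wp u := continuous_const.mul (hhc wp)
          exact ENNReal.continuous_ofReal.comp h1.rexp
      have hm : ∀ u : ℝ, Measurable fun wp : WienerPair => ENNReal.ofReal (Real.exp (θ * h wp u)) :=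
        fun u => by
          have h1 : Measurable fun wp : WienerPair => θ * h wp u := measurable_const.mul (hhm u)
          exact ENNReal.measurable_ofReal.comp h1.exp
      exact measurable_uncurry_of_continuous_of_measurable hc hm
    have hswap : ∫⁻ wp, (∫⁻ u in Ioc 0 s, ENNReal.ofReal (Real.exp (θ * h wp u))) ∂wienerPair =
        ∫⁻ u in Ioc 0 s, (∫⁻ wp, ENNReal.ofReal (Real.exp (θ * h wp u)) ∂wienerPair) :=
      (lintegral_lintegral_swap (μ := volume.restrict (Ioc 0 s)) (ν := wienerPair)
        hG_meas.aemeasurable).symm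
    -- Step 4: the inner time integral as a Lebesgue integral
    have hGc : ∀ wp, Continuous fun u => Real.exp (θ * h wp u) := fun wp => by
      have h1 : Continuous fun u : ℝ => θ * h wp u := continuous_const.mul (hhc wp)
      exact h1.rexp
    have hinner : ∀ wp, ENNReal.ofReal (∫ u in (0 : ℝ)..s, Real.exp (θ * h wp u)) =
        ∫⁻ u in Ioc 0 s, ENNReal.ofReal (Real.exp (θ * h wp u)) := fun wp => by
      rw [intervalIntegral.integral_of_le hs.1]
      exact ofReal_integral_eq_lintegral_ofReal
        ((hGc wp).integrableOn_Icc.mono_set Ioc_subset_Icc_self)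
        (ae_of_all _ fun u => (Real.exp_pos _).le)
    -- Step 5: CEHR fixed-time exponential moment along the flow, uniformly on `(0, s]`
    have hce : ∀ u ∈ Ioc (0 : ℝ) s,
        ∫⁻ wp, ENNReal.ofReal (Real.exp (θ * h wp u)) ∂wienerPair ≤
          ENNReal.ofReal (Real.exp (θ * γ * (T_L + T_R)) *
            Real.exp (θ * (pinnedChain ω₂ lam β γ).hamiltonian N z)) := by
      intro u hu
      have h34 := pinnedChain_lintegral_exp_hamiltonian_solMap_le hω hl hβ hγ hN hTL hTR hθ hθ'
        u.toNNReal z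
      rw [Real.coe_toNNReal u hu.1.le] at h34
      refine h34.trans (ENNReal.ofReal_le_ofReal
        (mul_le_mul_of_nonneg_right (Real.exp_le_exp.2 ?_) (Real.exp_pos _).le))
      have hu1 : u ≤ 1 := hu.2.trans hs.2
      exact mul_le_of_le_one_right hγT hu1
    -- Step 6: integrate, swap (Tonelli), bound
    calc ∫⁻ wp, ENNReal.ofReal (J wp) ^ q ∂wienerPair
        ≤ ∫⁻ wp, ENNReal.ofReal (Real.exp K₁ * s⁻¹) *
            ENNReal.ofReal (∫ u in (0 : ℝ)..s, Real.exp (θ * h wp u)) ∂wienerPair := by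
          refine lintegral_mono fun wp => ?_
          rw [ENNReal.ofReal_rpow_of_nonneg (norm_nonneg _) hq0,
            ← ENNReal.ofReal_mul (by positivity)]
          exact ENNReal.ofReal_le_ofReal (bound wp)
      _ = ENNReal.ofReal (Real.exp K₁ * s⁻¹) *
            ∫⁻ wp, (∫⁻ u in Ioc 0 s, ENNReal.ofReal (Real.exp (θ * h wp u))) ∂wienerPair := by
          rw [lintegral_const_mul' _ _ ENNReal.ofReal_ne_top]
          congr 1
          exact lintegral_congr fun wp => hinner wp
      _ = ENNReal.ofReal (Real.exp K₁ * s⁻¹) *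
            ∫⁻ u in Ioc 0 s, (∫⁻ wp, ENNReal.ofReal (Real.exp (θ * h wp u)) ∂wienerPair) := by
          rw [hswap]
      _ ≤ ENNReal.ofReal (Real.exp K₁ * s⁻¹) *
            ∫⁻ _u in Ioc 0 s, ENNReal.ofReal (Real.exp (θ * γ * (T_L + T_R)) *
              Real.exp (θ * (pinnedChain ω₂ lam β γ).hamiltonian N z)) :=
          mul_le_mul' le_rfl (setLIntegral_mono measurable_const hce)
      _ = ENNReal.ofReal (Real.exp K₁ * s⁻¹) * (ENNReal.ofReal (Real.exp (θ * γ * (T_L + T_R)) *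
              Real.exp (θ * (pinnedChain ω₂ lam β γ).hamiltonian N z)) * ENNReal.ofReal s) := by
          rw [setLIntegral_const, Real.volume_Ioc, sub_zero]
      _ = ENNReal.ofReal (Real.exp (K₁ + θ * γ * (T_L + T_R)) *
            Real.exp (θ * (pinnedChain ω₂ lam β γ).hamiltonian N z)) := by
          rw [← ENNReal.ofReal_mul (by positivity), ← ENNReal.ofReal_mul (by positivity)]
          congr 1
          rw [Real.exp_add]
          calc Real.exp K₁ * s⁻¹ * (Real.exp (θ * γ * (T_L + T_R)) *
                Real.exp (θ * (pinnedChain ω₂ lam β γ).hamiltonian N z) * s)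
              = Real.exp K₁ * Real.exp (θ * γ * (T_L + T_R)) *
                Real.exp (θ * (pinnedChain ω₂ lam β γ).hamiltonian N z) * (s⁻¹ * s) := by ring
            _ = _ := by rw [inv_mul_cancel₀ hs0.ne', mul_one]

end Moment

/-! ## 3. (JM) -/

/-- **(JM) `FlowJacobianMoment` — PROVED** (equal temperatures `T_L = T_R = T`,
`θ = min ε (1/(2T))`, `C = exp(A₀ + q A₁²/(4θ) + 2θγT)`).
[cite: CuneoEckmannHairerReyBellet2018, §3 eq. (3.4)] -/
theorem flowJacobianMoment : FlowJacobianMoment := by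
  intro ω₂ lam β γ hω hl hβ hγ T hT N hN q ε hq hε
  have hN0 : 0 < N := by omega
  -- the exponential-moment parameter
  obtain ⟨θ, hθ, hθε, hθ'⟩ : ∃ θ : ℝ, 0 < θ ∧ θ ≤ ε ∧ θ < 1 / max T T := by
    refine ⟨min ε (1 / (2 * T)), lt_min hε (by positivity), min_le_left _ _, ?_⟩
    rw [max_self]
    calc min ε (1 / (2 * T)) ≤ 1 / (2 * T) := min_le_right _ _
      _ < 1 / T := one_div_lt_one_div_of_lt hT (by linarith)
  refine ⟨Real.exp (driftA₀ ω₂ γ N + q * driftA₁ lam β N ^ 2 / (4 * θ) + θ * γ * (T + T)), ?_⟩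
  intro s hs0 hs1 b _ z
  have hmain := lintegral_rpow_norm_fderiv_solMap_le hω hl.le hβ.le hγ.le hN0 hT hT hq hθ hθ'
    ⟨hs0, hs1⟩ b z
  refine hmain.trans (ENNReal.ofReal_le_ofReal ?_)
  have hH0 : 0 ≤ (pinnedChain ω₂ lam β γ).hamiltonian N z :=
    pinnedChain_hamiltonian_nonneg hω.le hl.le hβ.le γ N z
  set H := (pinnedChain ω₂ lam β γ).hamiltonian N z with hH
  set A₀ := driftA₀ ω₂ γ N with hA₀
  set A₁ := driftA₁ lam β N with hA₁
  rw [Real.mul_rpow (Real.exp_pos _).le (Real.exp_pos _).le, ← Real.exp_mul, ← Real.exp_mul,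
    ← Real.exp_add, ← Real.exp_add, Real.exp_le_exp]
  have h1 : θ * γ * (T + T) ≤ θ * γ * (T + T) * q :=
    le_mul_of_one_le_right (by positivity) hq
  have h2 : θ * H ≤ ε * H * q := by
    have h21 : θ * H ≤ ε * H := mul_le_mul_of_nonneg_right hθε hH0
    have h22 : ε * H ≤ ε * H * q := le_mul_of_one_le_right (by positivity) hq
    linarith
  have h3 : (A₀ + q * A₁ ^ 2 / (4 * θ) + θ * γ * (T + T)) * q =
      q * A₀ + q ^ 2 * A₁ ^ 2 / (4 * θ) + θ * γ * (T + T) * q := by ring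
  linarith

end Summit.AtomisticToContinuum.FouriersLaw.Theorems.ExtensiveSnapshotIrreversibility.EnergyWindow

end
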